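import Summits.FinalStateConjecture.FinalStateConjecture.Theorems.SwallowTheDatumKerrShieldedSettlesStubExteriorTransportAux
import Literature.Geometry.Lorentzian.CausalityAchronalProofs
import Literature.Geometry.Lorentzian.LocalIsometryJetRigidity
import Literature.Geometry.Manifold.InverseFunctionTheorem
import HarnessLib

/-!
# `KerrShieldedSettles`, line `tapered-temporal-collar` — stub S7 `stub_exteriorTransport`, part 2:
# pulling timelike curves back through the chart map, and the last-exit argument

Support file for crux `stmt-FinalStateConjecture-10054`
(`Summit.FinalStateConjecture.FinalStateConjecture.Theses.SwallowTheDatum.KerrShieldedSettles`), stub S7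
`stub_exteriorTransport`.  The chart map `χ : Kerr.region a r₁ → N` is smooth, an open embedding, isometric and
oriented on the open tapered collar `W = {0 < x⁰ − T(r) + (r − r₁)/4}` only.  This part proves:

* `ExteriorTransport.lift` — a future timelike curve of `N` lying in `χ(W)` pulls back through `χ` to a future
  timelike curve of the chart lying in `W` (`χ|_W` is a homeomorphism onto the open `χ(W)` and a local
  diffeomorphism near each point: isometric differential between `4`-dimensional spaces,
  `JetRigidity.bijective_of_map_eq`, plus the inverse function theorem on manifolds
  `Literature.Geometry.Manifold.isLocalDiffeomorphAt_of_mfderiv`; timelike by the isometry, future-directed by the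
  converse timecone lemma `ScriTransport.isFutureDirected_of_mfderiv_of_iso`; pattern of `TimelikeCurveLift`);
* `ExteriorTransport.mem_image_of_lastExit` (registered sub-goal `stub_exteriorTransportLastExit`) — the
  LAST-EXIT ARGUMENT of Disproof.lean §C1: for a Cauchy hypersurface `Σ ⊇ χ(bent leaf)`, `c ∈ O_K` and
  `q ∈ J⁺(Σ) ∩ I⁻(χ c)`, `q ∈ χ(O_K)`.  Follow the future timelike curve `β` from `q` to `χ c` backwards to its last
  exit `e` from `χ(W)`; the piece after `e` pulls back to a chart curve ending at `c`, along which `u = x⁰ − T(r)`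
  stays positive (a zero is a leaf point, a point of `Σ` chronologically after `q ∈ J⁺(Σ)`: push-up
  `CausalityPushUp` + achronality `IsCauchyHypersurface.isAchronal_holds`) and `r > r₊` (horizon barrier, part 1);
  an exit point `β e ∉ χ(W)` is excluded because the pulled-back piece has `t* > 0` bounded below, hence a past
  endpoint in `E4` (`Minkowski.not_bddBelow_time`) with `u ≥ 0`, `r ≥ r₊ > r₁`, i.e. in `W`, mapped to `β e` by
  uniqueness of limits; so `e = b₁` and `q = χ(α b₁)` with `u ≥ 0`, `r > r₊`.

References: B. O'Neill, *Semi-Riemannian geometry* (1983), Ch. 3, pp. 58, 90, Ch. 5, p. 145, Ch. 14, Cor. 14.1,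
Lemma 14.29; J. M. Lee, *Introduction to Smooth Manifolds* (2013), Thm. 4.5; M. Dafermos, I. Rodnianski,
arXiv:0811.0354, §5.1.
-/

set_option linter.dupNamespace false

noncomputable section

open Set Filter Function
open scoped Manifold ContDiff Topology
open Literature.Geometry.Lorentzian
open Summit.FinalStateConjecture.FinalStateConjecture.Theorems.KerrShieldedDataExist.Negative
  (bentHeight mass_pos continuous_bentHeight rMinus_nonneg)

namespace Summit.FinalStateConjecture.FinalStateConjecture.Theorems.SwallowTheDatum.KerrShieldedSettles

namespace ExteriorTransport

section Lift

variable [Kerr.Facts] {M a r₁ : ℝ}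
  {N : Type*} [TopologicalSpace N] [ChartedSpace E4 N] [IsManifold (𝓡 4) ∞ N]
  {g : LorentzianMetric (𝓡 4) ∞ N} {τ : TimeOrientation g} {χ : Kerr.region a r₁ → N}

omit [Kerr.Facts] in
/-- **At a point of the collar the chart map is a local diffeomorphism**: its differential is a linear isometry of
`g_{M,a}` (nondegenerate) into `g` between spaces of the same finite dimension, hence bijective
(`JetRigidity.bijective_of_map_eq`), and the inverse function theorem on manifolds applies
(`Literature.Geometry.Manifold.isLocalDiffeomorphAt_of_mfderiv`). O'Neill 1983, Ch. 3, p. 90; Lee 2013,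
Thm. 4.5. [cite: ONeill1983, Ch. 3, p. 90] -/
theorem isLocalDiffeomorphAt_of_iso (hM0 : 0 < M)
    (hχs : ContMDiffOn 𝓘(ℝ, E4) (𝓡 4) ∞ χ
      {x | 0 < (x : E4) 0 - bentHeight M a (Kerr.radius a (x : E4)) + (Kerr.radius a (x : E4) - r₁) / 4})
    {x : Kerr.region a r₁}
    (hxW : 0 < (x : E4) 0 - bentHeight M a (Kerr.radius a (x : E4)) + (Kerr.radius a (x : E4) - r₁) / 4)
    (hiso : ∀ v w : E4, g.val (χ x) (mfderiv 𝓘(ℝ, E4) (𝓡 4) χ x v) (mfderiv 𝓘(ℝ, E4) (𝓡 4) χ x w) =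
      Kerr.bilin M a (x : E4) v w) :
    IsLocalDiffeomorphAt 𝓘(ℝ, E4) (𝓡 4) ∞ χ x := by
  have hxr : 0 < Kerr.radius a (x : E4) := Kerr.radius_pos_of_mem_region x.2
  have hbij : Bijective (mfderiv 𝓘(ℝ, E4) (𝓡 4) χ x) :=
    JetRigidity.bijective_of_map_eq (E := E4) (F := E4)
      (q₁ := (Kerr.bilin M a (x : E4) : E4 →L[ℝ] E4 →L[ℝ] ℝ))
      (q₂ := (g.val (χ x) : E4 →L[ℝ] E4 →L[ℝ] ℝ))
      (A := (mfderiv 𝓘(ℝ, E4) (𝓡 4) χ x : E4 →L[ℝ] E4)) rfl (Kerr.bilin_nondegenerate M a hxr) hiso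
  obtain ⟨e, he⟩ := JetRigidity.isInvertible_of_bijective (F := E4) (G := E4) hbij
  exact Literature.Geometry.Manifold.isLocalDiffeomorphAt_of_mfderiv (by simp)
    (CollarEmbedsMGHD.collar M a r₁ hM0).isOpen hxW hχs e he.symm

/-- **Pull-back of future timelike curves through the chart map.**  Let `χ` be smooth, an open embedding,
isometric and oriented on the collar `W`, and let `β` be a future timelike curve of `(N, g, τ)` on a parameter set
`s` with `β t ∈ χ(W)` for `t ∈ s`.  Then there is a future timelike curve `α` of the Kerr chart on `s`, with values
in `W` and `χ ∘ α = β` on `s`: `α = (χ|_W)⁻¹ ∘ β` is continuous (homeomorphism onto the open image), agrees near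
each parameter with `(local inverse of χ) ∘ β` (`isLocalDiffeomorphAt_of_iso`), hence is differentiable with
`dχ(α') = β'`; it is timelike because `dχ` is isometric and future-directed by the converse timecone lemma
`ScriTransport.isFutureDirected_of_mfderiv_of_iso`.  (Pattern of `LorentzianMetric.exists_lift_isEndlessTimelikeCurve`.)
O'Neill 1983, Ch. 3, pp. 90–91, Ch. 5, p. 145. [cite: ONeill1983, Ch. 3, pp. 90–91] -/
theorem lift (hM0 : 0 < M) (hM : 0 ≤ M)
    (hχs : ContMDiffOn 𝓘(ℝ, E4) (𝓡 4) ∞ χ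
      {x | 0 < (x : E4) 0 - bentHeight M a (Kerr.radius a (x : E4)) + (Kerr.radius a (x : E4) - r₁) / 4})
    (hχe : Topology.IsOpenEmbedding (Set.restrict {x : Kerr.region a r₁ |
      0 < (x : E4) 0 - bentHeight M a (Kerr.radius a (x : E4)) + (Kerr.radius a (x : E4) - r₁) / 4} χ))
    (hχg : ∀ x : Kerr.region a r₁, 0 < (x : E4) 0 - bentHeight M a (Kerr.radius a (x : E4)) +
          (Kerr.radius a (x : E4) - r₁) / 4 →
        (∀ v w : E4, g.val (χ x) (mfderiv 𝓘(ℝ, E4) (𝓡 4) χ x v)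
            (mfderiv 𝓘(ℝ, E4) (𝓡 4) χ x w) = Kerr.bilin M a (x : E4) v w) ∧
        g.val (χ x) (τ.vectorField (χ x))
            (mfderiv 𝓘(ℝ, E4) (𝓡 4) χ x (Kerr.timeVector M a (x : E4))) < 0)
    {β : ℝ → N} {s : Set ℝ} (hβ : g.IsFutureTimelikeCurveOn τ β s)
    (hV : ∀ t ∈ s, β t ∈ range (Set.restrict {x : Kerr.region a r₁ |
      0 < (x : E4) 0 - bentHeight M a (Kerr.radius a (x : E4)) + (Kerr.radius a (x : E4) - r₁) / 4} χ)) :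
    ∃ α : ℝ → Kerr.region a r₁,
      (∀ t ∈ s, 0 < (α t : E4) 0 - bentHeight M a (Kerr.radius a (α t : E4)) + (Kerr.radius a (α t : E4) - r₁) / 4 ∧
        χ (α t) = β t) ∧
      (Kerr.smoothMetric M a r₁).IsFutureTimelikeCurveOn ((Kerr.timeOrientation M a r₁ hM).ofLE le_top) α s := by
  classical
  rcases s.eq_empty_or_nonempty with rfl | ⟨t₀, ht₀⟩
  · haveI := Kerr.connectedSpace_region a r₁
    exact ⟨fun _ ↦ Classical.arbitrary _, fun t ht ↦ ht.elim, fun t ht ↦ ht.elim⟩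
  -- the collar as a subtype, the homeomorphism onto the image, and the pulled-back curve
  set W : Set (Kerr.region a r₁) := {x : Kerr.region a r₁ |
    0 < (x : E4) 0 - bentHeight M a (Kerr.radius a (x : E4)) + (Kerr.radius a (x : E4) - r₁) / 4} with hW
  obtain ⟨⟨x₀, hx₀W⟩, -⟩ := hV t₀ ht₀
  haveI : Nonempty W := ⟨⟨x₀, hx₀W⟩⟩
  set Φ := hχe.toOpenPartialHomeomorph (Set.restrict W χ) with hΦ
  have hΦt : Φ.target = range (Set.restrict W χ) := hχe.toOpenPartialHomeomorph_target _
  set α : ℝ → Kerr.region a r₁ := fun t ↦ ((Φ.symm (β t) : W) : Kerr.region a r₁) with hα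
  have hαW : ∀ t, α t ∈ W := fun t ↦ (Φ.symm (β t)).2
  have hχα : ∀ t', β t' ∈ range (Set.restrict W χ) → χ (α t') = β t' :=
    fun t' h ↦ hχe.toOpenPartialHomeomorph_right_inv _ h
  have hVo : IsOpen (range (Set.restrict W χ)) := hχe.isOpen_range
  have hcontβ : ∀ t ∈ s, ContinuousAt β t := fun t ht ↦ (hβ t ht).1.continuousAt
  have hcontα : ∀ t ∈ s, ContinuousAt α t := fun t ht ↦ by
    have h1 := Φ.continuousOn_symm.continuousAt (Φ.open_target.mem_nhds (by rw [hΦt]; exact hV t ht))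
    exact continuous_subtype_val.continuousAt.comp (h1.comp (hcontβ t ht))
  have hevV : ∀ t ∈ s, ∀ᶠ t' in 𝓝 t, β t' ∈ range (Set.restrict W χ) := fun t ht ↦
    (hcontβ t ht).preimage_mem_nhds (hVo.mem_nhds (hV t ht))
  refine ⟨α, fun t ht ↦ ⟨hαW t, hχα t (hV t ht)⟩, fun t ht ↦ ?_⟩
  -- local diffeomorphism at `α t`, and `α = (local inverse) ∘ β` near `t`
  obtain ⟨hiso, hor⟩ := hχg (α t) (hαW t)
  have hloc : IsLocalDiffeomorphAt 𝓘(ℝ, E4) (𝓡 4) ∞ χ (α t) := isLocalDiffeomorphAt_of_iso hM0 hχs (hαW t) hiso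
  have hev : α =ᶠ[𝓝 t] (hloc.localInverse ∘ β) := by
    have h1 : ∀ᶠ t' in 𝓝 t, α t' ∈ hloc.localInverse.target :=
      (hcontα t ht).preimage_mem_nhds (hloc.localInverse.open_target.mem_nhds hloc.localInverse_mem_target)
    filter_upwards [h1, hevV t ht] with t' h1' h2'
    show α t' = hloc.localInverse (β t')
    rw [← hχα t' h2', hloc.localInverse_left_inv h1']
  have hβd : MDifferentiableAt 𝓘(ℝ, ℝ) (𝓡 4) β t := (hβ t ht).1
  have hli : MDifferentiableAt (𝓡 4) 𝓘(ℝ, E4) hloc.localInverse (β t) := by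
    rw [← hχα t (hV t ht)]; exact hloc.localInverse_mdifferentiableAt (by simp)
  have hαd : MDifferentiableAt 𝓘(ℝ, ℝ) 𝓘(ℝ, E4) α t := hev.mdifferentiableAt_iff.2 (hli.comp t hβd)
  -- `dχ(α') = β'`
  have hχd : MDifferentiableAt 𝓘(ℝ, E4) (𝓡 4) χ (α t) :=
    ((hχs _ (hαW t)).contMDiffAt ((CollarEmbedsMGHD.collar M a r₁ hM0).isOpen.mem_nhds (hαW t))).mdifferentiableAt
      (by simp)
  have hev2 : β =ᶠ[𝓝 t] (χ ∘ α) := by filter_upwards [hevV t ht] with t' h using (hχα t' h).symm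
  have hvel : mfderiv 𝓘(ℝ, E4) (𝓡 4) χ (α t) (velocity 𝓘(ℝ, E4) α t) = velocity (𝓡 4) β t := by
    have h1 : mfderiv 𝓘(ℝ, ℝ) (𝓡 4) β t =
        (mfderiv 𝓘(ℝ, E4) (𝓡 4) χ (α t)).comp (mfderiv 𝓘(ℝ, ℝ) 𝓘(ℝ, E4) α t) := by
      rw [hev2.mfderiv_eq, mfderiv_comp t hχd hαd]
    change mfderiv 𝓘(ℝ, E4) (𝓡 4) χ (α t) (mfderiv 𝓘(ℝ, ℝ) 𝓘(ℝ, E4) α t (1 : ℝ)) = mfderiv 𝓘(ℝ, ℝ) (𝓡 4) β t (1 : ℝ)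
    rw [h1]; rfl
  -- read timelike / future-directed at the point `χ (α t) = β t`
  obtain ⟨-, htl, hfd⟩ := hβ t ht
  have key : ∀ p, p = β t → g.val p (velocity (𝓡 4) β t) (velocity (𝓡 4) β t) < 0 ∧
      τ.IsFutureDirected (x := p) (velocity (𝓡 4) β t) := by rintro p rfl; exact ⟨htl, hfd⟩
  obtain ⟨htl', hfd'⟩ := key (χ (α t)) (hχα t (hV t ht))
  rw [← hvel] at htl' hfd'
  refine ⟨hαd, ?_, ?_⟩
  · change Kerr.bilin M a (α t : E4) (velocity 𝓘(ℝ, E4) α t) (velocity 𝓘(ℝ, E4) α t) < 0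
    rw [← hiso]; exact htl'
  · exact ScriTransport.isFutureDirected_of_mfderiv_of_iso hM hiso hor hfd'

end Lift

/-! ## The last-exit argument -/

section LastExit

variable [Kerr.Facts] {M a r₁ : ℝ}
  {N : Type*} [TopologicalSpace N] [ChartedSpace E4 N] [IsManifold (𝓡 4) ∞ N] [T2Space N]
  [SecondCountableTopology N]
  {g : LorentzianMetric (𝓡 4) ∞ N} {τ : TimeOrientation g} {χ : Kerr.region a r₁ → N}

/-- **The last-exit argument** (Disproof.lean §C1 of the crux; registered sub-goal
`stub_exteriorTransportLastExit`).  Let `χ` be smooth, an open embedding, isometric and oriented on the collar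
`W`, let `Σ ⊆ N` be a Cauchy hypersurface containing the `χ`-image of the bent leaf `{x⁰ = T(r)}`, `c` a chart
point with `r(c) > r₊`, `c⁰ ≥ T(r c)`, and `q ∈ J⁺(Σ)` with `q ≪ χ c`.  Then `q = χ x` for a chart point `x` with
`r(x) > r₊`, `x⁰ ≥ T(r x)`.  See the module docstring for the proof (last exit `e` of the connecting timelike curve
from `χ(W)`; pull-back `lift`; `u > 0` along it by leaf crossing + push-up + achronality of `Σ`; `r > r₊` by the
horizon barrier; no exit by the escape analysis of `Minkowski.not_bddBelow_time` and uniqueness of limits).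
O'Neill 1983, Ch. 14, Cor. 14.1 and Lemma 14.29; Dafermos–Rodnianski arXiv:0811.0354, §5.1.
[cite: ONeill1983, Ch. 14, Lemma 14.29] -/
theorem mem_image_of_lastExit (hM : 0 ≤ M) (ha : |a| < M) (hr₁ : Kerr.rMinus M a < r₁)
    (hr₂ : r₁ < Kerr.rPlus M a)
    (hχs : ContMDiffOn 𝓘(ℝ, E4) (𝓡 4) ∞ χ
      {x | 0 < (x : E4) 0 - bentHeight M a (Kerr.radius a (x : E4)) + (Kerr.radius a (x : E4) - r₁) / 4})
    (hχe : Topology.IsOpenEmbedding (Set.restrict {x : Kerr.region a r₁ |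
      0 < (x : E4) 0 - bentHeight M a (Kerr.radius a (x : E4)) + (Kerr.radius a (x : E4) - r₁) / 4} χ))
    (hχg : ∀ x : Kerr.region a r₁, 0 < (x : E4) 0 - bentHeight M a (Kerr.radius a (x : E4)) +
          (Kerr.radius a (x : E4) - r₁) / 4 →
        (∀ v w : E4, g.val (χ x) (mfderiv 𝓘(ℝ, E4) (𝓡 4) χ x v)
            (mfderiv 𝓘(ℝ, E4) (𝓡 4) χ x w) = Kerr.bilin M a (x : E4) v w) ∧
        g.val (χ x) (τ.vectorField (χ x))
            (mfderiv 𝓘(ℝ, E4) (𝓡 4) χ x (Kerr.timeVector M a (x : E4))) < 0)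
    {S : Set N} (hCS : g.IsCauchyHypersurface τ S)
    (hleaf : ∀ x : Kerr.region a r₁, (x : E4) 0 = bentHeight M a (Kerr.radius a (x : E4)) → χ x ∈ S)
    {c : Kerr.region a r₁} (hc : Kerr.rPlus M a < Kerr.radius a (c : E4) ∧
      bentHeight M a (Kerr.radius a (c : E4)) ≤ (c : E4) 0)
    {q : N} (hqJ : q ∈ g.causalFuture τ S) (hqI : q ∈ g.chronologicalPast τ {χ c}) :
    q ∈ χ '' {x : Kerr.region a r₁ | Kerr.rPlus M a < Kerr.radius a (x : E4) ∧
      bentHeight M a (Kerr.radius a (x : E4)) ≤ (x : E4) 0} := by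
  have hM0 : 0 < M := mass_pos ha
  have h2le : (2 : ℕ∞ω) ≤ ∞ := WithTop.coe_le_coe.mpr le_top
  have h1le : (1 : ℕ∞ω) ≤ ∞ := WithTop.coe_le_coe.mpr le_top
  have hVo : IsOpen (range (Set.restrict {x : Kerr.region a r₁ |
      0 < (x : E4) 0 - bentHeight M a (Kerr.radius a (x : E4)) + (Kerr.radius a (x : E4) - r₁) / 4} χ)) :=
    hχe.isOpen_range
  have hinj : InjOn χ {x : Kerr.region a r₁ |
      0 < (x : E4) 0 - bentHeight M a (Kerr.radius a (x : E4)) + (Kerr.radius a (x : E4) - r₁) / 4} :=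
    injOn_iff_injective.2 hχe.injective
  have hr₁c : r₁ < Kerr.radius a (c : E4) := hr₂.trans hc.1
  have hcW : 0 < (c : E4) 0 - bentHeight M a (Kerr.radius a (c : E4)) + (Kerr.radius a (c : E4) - r₁) / 4 := by
    linarith [hc.2]
  -- the future timelike curve from `q` up to `χ c`
  obtain ⟨q', hq', β, b₁, b₂, hb, hβ, hβa, hβb⟩ :=
    LorentzianMetric.mem_chronologicalFuture_of_mem_chronologicalPast hqI
  rw [mem_singleton_iff] at hq'
  have hβa' : β b₁ = q := hβa.trans hq'
  have hcont : ∀ t ∈ Icc b₁ b₂, ContinuousAt β t := fun t ht ↦ (hβ t ht).1.continuousAt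
  -- `V = χ(W)` and the good parameters
  set V : Set N := range (Set.restrict {x : Kerr.region a r₁ |
    0 < (x : E4) 0 - bentHeight M a (Kerr.radius a (x : E4)) + (Kerr.radius a (x : E4) - r₁) / 4} χ) with hV
  have hβb₂V : β b₂ ∈ V := by rw [hβb]; exact ⟨⟨c, hcW⟩, rfl⟩
  -- no point of `β` strictly after `q` lies on `S` (push-up and achronality)
  have hnoS : ∀ t₁ ∈ Ioc b₁ b₂, β t₁ ∉ S := by
    intro t₁ ht₁ hS₁
    have h1 : β t₁ ∈ g.chronologicalFuture τ {q} := ⟨q, rfl, β, b₁, t₁, ht₁.1, hβ.mono (Icc_subset_Icc_right ht₁.2), hβa', rfl⟩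
    have hqJ' := hqJ
    rw [LorentzianMetric.causalFuture_eq_biUnion] at hqJ'; simp only [mem_iUnion, exists_prop] at hqJ'
    obtain ⟨p, hpS, hqp⟩ := hqJ'
    have h2 : β t₁ ∈ g.chronologicalFuture τ {p} := LorentzianMetric.mem_chronologicalFuture_of_mem_causalFuture h1le hqp h1
    exact LorentzianMetric.IsCauchyHypersurface.isAchronal_holds (g := g) (τ := τ) h2le hCS p hpS (β t₁) hS₁ h2
  -- the last exit of `β` from `V`, read backwards from `b₂`: the infimum of the set `A`
  set A : Set ℝ := {t | t ∈ Icc b₁ b₂ ∧ ∀ σ ∈ Icc t b₂, β σ ∈ V} with hA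
  have hb₂A : b₂ ∈ A := ⟨right_mem_Icc.2 hb.le, fun σ hσ ↦ by rw [show σ = b₂ from le_antisymm hσ.2 hσ.1]; exact hβb₂V⟩
  have hAne : A.Nonempty := ⟨b₂, hb₂A⟩
  have hAbdd : BddBelow A := ⟨b₁, fun t ht ↦ ht.1.1⟩
  have he₁ : b₁ ≤ sInf A := le_csInf hAne fun t ht ↦ ht.1.1
  have he₂ : sInf A ≤ b₂ := csInf_le hAbdd hb₂A
  have hgood : ∀ t ∈ Ioc (sInf A) b₂, β t ∈ V := by
    intro t ht
    obtain ⟨t', ht'A, ht't⟩ := exists_lt_of_csInf_lt hAne ht.1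
    exact ht'A.2 t ⟨ht't.le, ht.2⟩
  have heb : sInf A < b₂ := by
    have h1 := (hcont b₂ (right_mem_Icc.2 hb.le)).preimage_mem_nhds (hVo.mem_nhds hβb₂V)
    obtain ⟨δ, hδ, hball⟩ := Metric.mem_nhds_iff.1 h1
    have htA : max b₁ (b₂ - δ / 2) ∈ A := by
      refine ⟨⟨le_max_left _ _, max_le hb.le (by linarith)⟩, fun σ hσ ↦ hball ?_⟩
      rw [Metric.mem_ball, Real.dist_eq, abs_lt]
      constructor <;> linarith [le_max_right b₁ (b₂ - δ / 2), hσ.1, hσ.2]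
    calc sInf A ≤ max b₁ (b₂ - δ / 2) := csInf_le hAbdd htA
      _ < b₂ := max_lt hb (by linarith)
  have hb₂S : b₂ ∈ Ioc (sInf A) b₂ := ⟨heb, le_rfl⟩
  have hSI : Ioc (sInf A) b₂ ⊆ Icc b₁ b₂ := fun t ht ↦ ⟨he₁.trans ht.1.le, ht.2⟩
  -- pull the good piece back to the chart
  obtain ⟨α, hα, hαc⟩ := lift hM0 hM hχs hχe hχg (hβ.mono hSI) hgood
  have hαb₂ : α b₂ = c := hinj (hα b₂ hb₂S).1 hcW (by rw [(hα b₂ hb₂S).2, hβb])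
  -- `u > 0` along the pulled-back piece (else a leaf point of `β` after `q`)
  have hupos : ∀ t ∈ Ioc (sInf A) b₂, 0 < (α t : E4) 0 - bentHeight M a (Kerr.radius a (α t : E4)) := by
    intro t ht
    by_contra hle; push Not at hle
    have hIcc : Icc t b₂ ⊆ Ioc (sInf A) b₂ := fun σ hσ ↦ ⟨ht.1.trans_le hσ.1, hσ.2⟩
    have hcu : ContinuousOn (fun σ ↦ (α σ : E4) 0 - bentHeight M a (Kerr.radius a (α σ : E4))) (Icc t b₂) :=
      fun σ hσ ↦ (CollarCauchy.hasDerivAt_u ha hαc (hIcc hσ)).continuousAt.continuousWithinAt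
    have huc : 0 ≤ (α b₂ : E4) 0 - bentHeight M a (Kerr.radius a (α b₂ : E4)) := by rw [hαb₂]; linarith [hc.2]
    obtain ⟨t₁, ht₁, ht₁0⟩ := intermediate_value_Icc ht.2 hcu ⟨hle, huc⟩
    have ht₁S : t₁ ∈ Ioc (sInf A) b₂ := hIcc ht₁
    have hleaf₁ : (α t₁ : E4) 0 = bentHeight M a (Kerr.radius a (α t₁ : E4)) := sub_eq_zero.1 ht₁0
    have hβt₁ : β t₁ ∈ S := by rw [← (hα t₁ ht₁S).2]; exact hleaf _ hleaf₁
    exact hnoS t₁ ⟨he₁.trans_lt ht₁S.1, ht₁S.2⟩ hβt₁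
  -- `r > r₊` along the pulled-back piece (horizon barrier)
  have hrpos : ∀ t ∈ Ioc (sInf A) b₂, Kerr.rPlus M a < Kerr.radius a (α t : E4) := fun t ht ↦
    radius_gt_of_le ha ordConnected_Ioc hαc hb₂S (by rw [hαb₂]; exact hc.1) ht ht.2
  by_cases heV : β (sInf A) ∈ V
  · -- no exit at all: `sInf A = b₁`, and `q = χ (α b₁)`
    have hee : sInf A = b₁ := by
      by_contra hne
      have hlt : b₁ < sInf A := lt_of_le_of_ne he₁ (Ne.symm hne)
      have h1 := (hcont (sInf A) ⟨he₁, he₂⟩).preimage_mem_nhds (hVo.mem_nhds heV)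
      obtain ⟨δ, hδ, hball⟩ := Metric.mem_nhds_iff.1 h1
      have hte : max b₁ (sInf A - δ / 2) < sInf A := max_lt hlt (by linarith)
      have htA : max b₁ (sInf A - δ / 2) ∈ A := by
        refine ⟨⟨le_max_left _ _, hte.le.trans he₂⟩, fun σ hσ ↦ ?_⟩
        rcases le_or_gt σ (sInf A) with hσe | hσe
        · refine hball ?_
          rw [Metric.mem_ball, Real.dist_eq, abs_lt]
          constructor <;> linarith [le_max_right b₁ (sInf A - δ / 2), hσ.1]
        · exact hgood σ ⟨hσe, hσ.2⟩
      exact absurd (csInf_le hAbdd htA) (not_le.2 hte)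
    have hgood' : ∀ t ∈ Icc b₁ b₂, β t ∈ V := by
      intro t ht
      rcases eq_or_lt_of_le ht.1 with h | h
      · rw [← h, ← hee]; exact heV
      · exact hgood t ⟨hee ▸ h, ht.2⟩
    obtain ⟨α₂, hα₂, hα₂c⟩ := lift hM0 hM hχs hχe hχg hβ hgood'
    have hagree : ∀ t ∈ Ioc (sInf A) b₂, α₂ t = α t := fun t ht ↦
      hinj (hα₂ t (hSI ht)).1 (hα t ht).1 (by rw [(hα₂ t (hSI ht)).2, (hα t ht).2])
    have hb₁I : b₁ ∈ Icc b₁ b₂ := left_mem_Icc.2 hb.le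
    refine ⟨α₂ b₁, ⟨?_, ?_⟩, (hα₂ b₁ hb₁I).2.trans hβa'⟩
    · have h2 : α₂ b₂ = c := (hagree b₂ hb₂S).trans hαb₂
      exact radius_gt_of_le ha ordConnected_Icc hα₂c (right_mem_Icc.2 hb.le) (by rw [h2]; exact hc.1) hb₁I hb.le
    · -- `u(α₂ b₁) ≥ 0` by continuity from the right
      have hcu : ContinuousWithinAt (fun σ ↦ (α₂ σ : E4) 0 - bentHeight M a (Kerr.radius a (α₂ σ : E4)))
          (Ioi b₁) b₁ := (CollarCauchy.hasDerivAt_u ha hα₂c hb₁I).continuousAt.continuousWithinAt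
      have hev : ∀ᶠ σ in 𝓝[>] b₁, (0 : ℝ) ≤ (α₂ σ : E4) 0 - bentHeight M a (Kerr.radius a (α₂ σ : E4)) := by
        filter_upwards [Ioc_mem_nhdsGT hb] with σ hσ
        have hσ' : σ ∈ Ioc (sInf A) b₂ := by rw [hee]; exact hσ
        rw [hagree σ hσ']; exact (hupos σ hσ').le
      have h0 := ge_of_tendsto hcu hev
      simp only at h0; linarith
  · -- an exit at `sInf A`: the pulled-back piece would have a past endpoint in `W` mapped to `β (sInf A)`
    exfalso
    haveI : Nonempty (Ioc (sInf A) b₂) := ⟨⟨b₂, hb₂S⟩⟩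
    have hbdd : BddBelow ((fun σ ↦ (α σ : E4) 0) '' Ioc (sInf A) b₂) := by
      refine ⟨0, ?_⟩
      rintro _ ⟨σ, hσ, rfl⟩
      have h1 := hupos σ hσ; have h2 := CollarCauchy.bentHeight_nonneg ha (Kerr.radius a (α σ : E4))
      simp only; linarith
    obtain ⟨z, hz⟩ : ∃ z : E4, HasPastEndpoint (fun σ ↦ (α σ : E4)) (Ioc (sInf A) b₂) z := by
      by_contra hcon; push Not at hcon
      exact Minkowski.not_bddBelow_time ordConnected_Ioc (CollarCauchy.minkowski_curve hαc) ⟨⟨b₂, hb₂S⟩, hcon⟩ hbdd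
    have hcontF : Continuous fun p : E4 ↦ p 0 - bentHeight M a (Kerr.radius a p) :=
      (PiLp.continuous_apply 2 _ 0).sub ((continuous_bentHeight ha).comp (Kerr.continuous_radius a))
    have hzr := ((Kerr.continuous_radius a).tendsto z).comp hz
    have hzu : Tendsto (fun σ : Ioc (sInf A) b₂ ↦ (α σ : E4) 0 - bentHeight M a (Kerr.radius a (α σ : E4)))
        atBot (𝓝 (z 0 - bentHeight M a (Kerr.radius a z))) := (hcontF.tendsto z).comp hz
    have hrz : Kerr.rPlus M a ≤ Kerr.radius a z := ge_of_tendsto' hzr fun σ ↦ (hrpos σ σ.2).le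
    have huz : 0 ≤ z 0 - bentHeight M a (Kerr.radius a z) := ge_of_tendsto' hzu fun σ ↦ (hupos σ σ.2).le
    have hzK : z ∈ Kerr.region a r₁ := by
      rw [Kerr.mem_region, max_eq_left ((rMinus_nonneg ha).trans hr₁.le)]; linarith
    have hzW : 0 < ((⟨z, hzK⟩ : Kerr.region a r₁) : E4) 0 -
        bentHeight M a (Kerr.radius a ((⟨z, hzK⟩ : Kerr.region a r₁) : E4)) +
        (Kerr.radius a ((⟨z, hzK⟩ : Kerr.region a r₁) : E4) - r₁) / 4 := by
      show 0 < z 0 - bentHeight M a (Kerr.radius a z) + (Kerr.radius a z - r₁) / 4; linarith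
    have hz' : HasPastEndpoint α (Ioc (sInf A) b₂) ⟨z, hzK⟩ :=
      (hasPastEndpoint_subtypeVal_comp_iff (p := (⟨z, hzK⟩ : Kerr.region a r₁))).1 hz
    have hz'' : Tendsto α (𝓝[>] (sInf A)) (𝓝 ⟨z, hzK⟩) := by
      have hm : (sInf A + b₂) / 2 ∈ Ioc (sInf A) b₂ := ⟨by linarith, by linarith⟩
      have hm' : (sInf A + b₂) / 2 ∈ Ioi (sInf A) := show sInf A < (sInf A + b₂) / 2 by linarith
      rw [hasPastEndpoint_congr_set hm hm' (fun t ht ↦ ⟨fun h ↦ h.1, fun h ↦ ⟨h, by linarith⟩⟩) _,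
        hasPastEndpoint_Ioi_iff] at hz'
      exact hz'
    have hβ1 : Tendsto β (𝓝[>] (sInf A)) (𝓝 (χ ⟨z, hzK⟩)) := by
      have hχz : ContinuousAt χ ⟨z, hzK⟩ :=
        ((hχs _ hzW).contMDiffAt ((CollarEmbedsMGHD.collar M a r₁ hM0).isOpen.mem_nhds hzW)).continuousAt
      refine (hχz.tendsto.comp hz'').congr' ?_
      filter_upwards [Ioc_mem_nhdsGT heb] with σ hσ using (hα σ hσ).2
    have hβ2 : Tendsto β (𝓝[>] (sInf A)) (𝓝 (β (sInf A))) :=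
      (hcont (sInf A) ⟨he₁, he₂⟩).continuousWithinAt
    have heq : β (sInf A) = χ ⟨z, hzK⟩ := tendsto_nhds_unique hβ2 hβ1
    exact heV ⟨⟨⟨z, hzK⟩, hzW⟩, heq.symm⟩

end LastExit

end ExteriorTransport

open ExteriorTransport in
/-- **Registered sub-goal `stub_exteriorTransportLastExit` — the last-exit argument of Disproof.lean §C1.**  For
sub-extremal `(M, a)`, `0 ≤ M`, `r₋ < r₁ < r₊`, a chart map `χ` from the ingoing Kerr–Schild chart into a
Hausdorff second-countable `4`-manifold `N` with a `C^∞` time-oriented Lorentzian metric, smooth, an open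
embedding, isometric and oriented on the tapered collar `W = {0 < x⁰ − T(r) + (r − r₁)/4}` (`T = bentHeight M a`),
a Cauchy hypersurface `Σ` of `N` containing the `χ`-image of the bent leaf `{x⁰ = T(r)}`, a chart point `c` of
`O_K = {r > r₊, x⁰ ≥ T(r)}` and a point `q ∈ J⁺(Σ) ∩ I⁻(χ c)`: `q ∈ χ(O_K)` (`ExteriorTransport.mem_image_of_lastExit`).
This is the reverse inclusion `J⁺(ιX) ∩ I⁻(χ(charted)) ⊆ χ(O_K)` of stub S7 `stub_exteriorTransport`.
O'Neill 1983, Ch. 14, Cor. 14.1 and Lemma 14.29; Dafermos–Rodnianski arXiv:0811.0354, §5.1.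
[cite: ONeill1983, Ch. 14, Lemma 14.29] -/
theorem stub_exteriorTransportLastExit : ∀ [Kerr.Facts] (M a r₁ : ℝ) (hM : 0 ≤ M), |a| < M →
    Kerr.rMinus M a < r₁ → r₁ < Kerr.rPlus M a →
    ∀ (N : Type) [TopologicalSpace N] [ChartedSpace E4 N] [IsManifold (𝓡 4) ((⊤ : ℕ∞) : WithTop ℕ∞) N]
      [T2Space N] [SecondCountableTopology N]
      (g : LorentzianMetric (𝓡 4) ((⊤ : ℕ∞) : WithTop ℕ∞) N) (τ : TimeOrientation g)
      (χ : Kerr.region a r₁ → N),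
      ContMDiffOn 𝓘(ℝ, E4) (𝓡 4) ((⊤ : ℕ∞) : WithTop ℕ∞) χ
          {x | 0 < (x : E4) 0 - bentHeight M a (Kerr.radius a (x : E4)) + (Kerr.radius a (x : E4) - r₁) / 4} →
      Topology.IsOpenEmbedding (Set.restrict {x : Kerr.region a r₁ |
          0 < (x : E4) 0 - bentHeight M a (Kerr.radius a (x : E4)) + (Kerr.radius a (x : E4) - r₁) / 4} χ) →
      (∀ x : Kerr.region a r₁, 0 < (x : E4) 0 - bentHeight M a (Kerr.radius a (x : E4)) +
            (Kerr.radius a (x : E4) - r₁) / 4 →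
          (∀ v w : E4, g.val (χ x) (mfderiv 𝓘(ℝ, E4) (𝓡 4) χ x v)
              (mfderiv 𝓘(ℝ, E4) (𝓡 4) χ x w) = Kerr.bilin M a (x : E4) v w) ∧
          g.val (χ x) (τ.vectorField (χ x))
              (mfderiv 𝓘(ℝ, E4) (𝓡 4) χ x (Kerr.timeVector M a (x : E4))) < 0) →
      ∀ (S : Set N), g.IsCauchyHypersurface τ S →
        (∀ x : Kerr.region a r₁, (x : E4) 0 = bentHeight M a (Kerr.radius a (x : E4)) → χ x ∈ S) →
        ∀ (c : Kerr.region a r₁), Kerr.rPlus M a < Kerr.radius a (c : E4) →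
          bentHeight M a (Kerr.radius a (c : E4)) ≤ (c : E4) 0 →
          ∀ q : N, q ∈ g.causalFuture τ S → q ∈ g.chronologicalPast τ {χ c} →
            q ∈ χ '' {x : Kerr.region a r₁ | Kerr.rPlus M a < Kerr.radius a (x : E4) ∧
              bentHeight M a (Kerr.radius a (x : E4)) ≤ (x : E4) 0} :=
  fun _ _ _ hM ha hr₁ hr₂ _ _ _ _ _ _ _ _ χ hχs hχe hχg _ hCS hleaf _ hc₁ hc₂ _ hqJ hqI ↦
    mem_image_of_lastExit (χ := χ) hM ha hr₁ hr₂ hχs hχe hχg hCS hleaf ⟨hc₁, hc₂⟩ hqJ hqI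

end Summit.FinalStateConjecture.FinalStateConjecture.Theorems.SwallowTheDatum.KerrShieldedSettles

end
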